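import Summits.MatrixMultiplication.OmegaCensus.STPPSmallPatternKernelSearchStab
import Summits.MatrixMultiplication.OmegaCensus.STPPSmallPatternKernelProduct

/-!
# ω-census, `(2,1,1)^6` is infeasible in `ℤ/2 × ℤ/14` — kernel search (stabiliser normal form), part 17 of 38

HONEST FRAMING (pub-omega census; verbatim): lottery ticket; floor = certified bounds/negative ranges.
Census STRUCTURE bookkeeping of the STPP track (seat pub-omega-eng2 = ENG2, gen 34, on the kernel engine of seat pub-omega-stpp-3 gen 23
with the stabiliser normal form / global mask of `STPPSmallPatternKernelSearchStab.lean`; STRUCTURE row B5, the threshold column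
`T1(H) = max {k : (2,1,1)^k ⊆ H}`, lower side of the `k = 6` ORDER LAW `(2,1,1)⁶ ⊆ G ↔ 30 ≤ |G|`), not progress on `ω`: small patterns
in small groups bound no exponent.

Chunks of the kernel mask search `STPP211Neg.search3 (prodGC 2 (zcode 14)) 6` (`decide +kernel`; ≈ 194 s of kernel time predicted); assembled in
`STPPSmallPatternNone211K6P2x14.lean`.  Chunk entries `(d, x1, x2, x3, xg)`: representative `d` of `A₀ = {0, d}`, exclusion masks of the first three levels, global
exclusion mask (`STPPSmallPatternKernelSearchStab.lean`).

References: H. Cohn, R. Kleinberg, B. Szegedy, C. Umans, FOCS 2005 (arXiv:math/0511460), Def. 5.1.  Record: pub-omega HOME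
`pub-omega-eng2-g34/` (ENG2's C mirror `k211g.c` of the kernel tree with the level-1 and global exclusion masks — `k211c.c` of gen 33
validated to the translation count against stpp-3's `k211v3.py` — gives COMPLETE NONE on this cell with 93385009 mask translations over the
canonical first levels; planner `plan3.py`; farm calibration 67 µs per translation; not used by the proofs).
-/

set_option Elab.async false  -- several kernel pieces: elaborate sequentially (memory)

namespace Summit.MatrixMultiplication.OmegaCensus

namespace STPP211Neg

/-- Chunk list 42 of `ℤ/2 × ℤ/14`, `k = 6` (797454 mask translations in the mirror ≈ 53 s predicted). -/
def P2_14k6.ch42 : List (ℕ × ℕ × ℕ × ℕ × ℕ) :=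
  [(15, 268435391, 90177535, 89472575, 89472575), (15, 268435327, 89472895, 89472895, 89472895),
    (15, 268304383, 223739903, 223739903, 223739903), (15, 267911167, 257425407, 257425407, 257425407),
    (15, 266338303, 266338303, 266338303, 266338303)]

/-- Kernel search over chunk list 42 of `ℤ/2 × ℤ/14`, `k = 6`. -/
theorem P2_14k6.s42 : search3 (prodGC 2 (zcode 14)) 6 P2_14k6.ch42 = true := by
  decide +kernel

/-- Chunk list 43 of `ℤ/2 × ℤ/14`, `k = 6` (1177616 mask translations in the mirror ≈ 79 s predicted). -/
def P2_14k6.ch43 : List (ℕ × ℕ × ℕ × ℕ × ℕ) :=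
  [(2, 268435453, 268435417, 1, 1)]

/-- Kernel search over chunk list 43 of `ℤ/2 × ℤ/14`, `k = 6`. -/
theorem P2_14k6.s43 : search3 (prodGC 2 (zcode 14)) 6 P2_14k6.ch43 = true := by
  decide +kernel

/-- Chunk list 44 of `ℤ/2 × ℤ/14`, `k = 6` (927500 mask translations in the mirror ≈ 62 s predicted). -/
def P2_14k6.ch44 : List (ℕ × ℕ × ℕ × ℕ × ℕ) :=
  [(2, 268435453, 268435391, 1, 1)]

/-- Kernel search over chunk list 44 of `ℤ/2 × ℤ/14`, `k = 6`. -/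
theorem P2_14k6.s44 : search3 (prodGC 2 (zcode 14)) 6 P2_14k6.ch44 = true := by
  decide +kernel

/-- The chunk lists of this part, concatenated. -/
def P2_14k6.part17 : List (ℕ × ℕ × ℕ × ℕ × ℕ) :=
  P2_14k6.ch42 ++ P2_14k6.ch43 ++ P2_14k6.ch44

/-- The kernel search over this part's chunks (assembled). -/
theorem P2_14k6.ps17 : search3 (prodGC 2 (zcode 14)) 6 P2_14k6.part17 = true := by
  simp only [P2_14k6.part17, search3_append, P2_14k6.s42, P2_14k6.s43, P2_14k6.s44, Bool.and_self]

end STPP211Neg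

end Summit.MatrixMultiplication.OmegaCensus
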